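import Summits.BirchSwinnertonDyer.BirchSwinnertonDyer.Theorems.ResidualThetaTransportAtTwoResidualSignedLambdaLowerCMAtTwoOfIntDualityData
import HarnessLib

/-!
# Clause (8) of the one-pair duality datum is DERIVABLE: `ℚ₂ ⊗ (P ⧸ locd Z)` is finite from (DH) + the two global finiteness inputs

Route `ResidualThetaTransportAtTwo` (RTT), crux RSL_g `ResidualSignedLambdaLowerCMAtTwo` (stmt-BirchSwinnertonDyer-22608), line «onepair»
(skeleton v2c); seat `prover-bsd-wall-tp2-p2x-w2` g19 (`--supports`, closes nothing). THEOREMS ONLY (no definition, no named fact, no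
instance, no `sorry`). STUB-PLAN rev 19 Q80 / S79 (a) (credit: stub-ideation card k1-g13). BSD is not proved by any of this; RSL_g is not
proved here.

-- adapted from `Cruxes/ResidualThetaCountLowerPureAtTwo/Sketch_sidea_k1_g13.lean` (stub-ideation k1 g13, kernel-checked there, Mathlib-only):
-- §1–§2 are its (H-b)/(H-c)/(L1)/(L2)/(L1-cor)/(H-a)/`span_image_eq_map` with the namespace moved under `Theorems.LambdaLowerBoundO`; the
-- `instance flat_padic` of the sketch is replaced by a local `haveI` (no instance is declared); the signature-only `def FracToPadicCurrency`
-- is dropped (the entry converts currencies itself, `…OfIntDualityData` :163–166). §3 is new: the dischargers in the ENTRY's binder currency.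

WHY. The N5 entry in mixed ℤ₂/𝒪-currency, `LambdaLowerBoundO.le_finrank_characterModule_of_intDualityData` (p679392), and through it
`cmLambdaLower_of_intDualityData` / `residualSignedLambdaLowerCMAtTwo_of_parts` (p682462, the `_of` of `Lines/onepair.lean`), carry the
hypothesis `hfinP : Module.Finite ℚ_[p] (ℚ_[p] ⊗[ℤ_[p]] (P ⧸ Submodule.span ℤ_[p] (locd '' Z)))` = clause (8) of the supply datum. It is a
CONSEQUENCE of the other clauses: (DH) `pair t = 0 → ∃ a ≠ 0, ∃ x, a • t = locd x`, clause (7) `Frac 𝒪 ⊗_𝒪 (H ⧸ Z)` finite, and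
`Frac 𝒪 ⊗_𝒪 Sg⋆` finite (which the entry already derives from the supply's `hfin` via p665052
`module_finite_characterModule_of_finite_scalarH1_torsion`). No finiteness of any LOCAL block of `P` is needed, (ORTH)/(EH) are not used.
So the split supplies (S57/S76) never have to produce clause (8), and the level blocks `w ∣ M` may ride inside `P` uncounted (S79).

PROOF of (L1) (three-step filtration of `Q := P ⧸ locd Z`): `S₁ := locd H ⧸ locd Z` is a quotient of `H ⧸ Z` (finite after `K ⊗`);
`S₂ := (locd H + ker pair) ⧸ locd Z` has `S₂ ⧸ S₁` elementwise torsion by (DH), so `K ⊗ (S₂ ⧸ S₁) = 0`; `Q ⧸ S₂ ≅ P ⧸ (locd H + ker pair)` is a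
quotient of `P ⧸ ker pair ↪ D`, finite after `K ⊗` by FLATNESS of `K` over `R` and finiteness of `K ⊗ D`; extensions by (H-b).

* §1 (generic `R → K`, `K` a field): `finite_baseChange_of_submodule` (H-b), `subsingleton_baseChange_of_torsion` /
  `finite_baseChange_of_torsion` (H-c), **`finite_baseChange_quotient_of_dualityData`** (L1, `[Module.Flat R K]`),
  **`finrank_baseChange_quotient_map_le`** (L2: forgetting blocks along a surjection `π : P ↠ P♮` can only LOWER the counted rank).
* §2 (`R = ℤ_[p]`, `K = ℚ_[p]`, slack `a ≠ 0`): `isUnit_algebraMap_padicInt_of_ne_zero`, **`finite_padic_baseChange_quotient_of_dualityData`**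
  (L1-cor, `hDH` in the datum's literal shape), `finite_padic_baseChange_of_finite_over` (H-a), `span_image_eq_map`.
* §3 (the ENTRY's exact binders — additive `pair : P →+ CharacterModule Sel`, `locd : H →+ P`, `Z : Submodule 𝒪 H`, `hpair`, `hlocd`, `hDH`,
  `hfinH` in `Frac 𝒪`-currency, `[Module.Finite (Frac 𝒪) (Frac 𝒪 ⊗_𝒪 Sel⋆)]`): **`finite_padic_baseChange_quotient_span_of_intDualityData`**
  produces the `hfinP` slot of `le_finrank_characterModule_of_intDualityData` VERBATIM, and
  **`le_finrank_characterModule_of_intDualityData_finFree`** is that entry with clause (8) removed.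

References: [Kobayashi2003] Thm. 7.3 ((7.21), p. 13); [MilneADT2006] Ch. I Thm. 4.10; [Washington1997] §13.2 (λ as a rank);
[Matsumura1987] §7 (flatness: flat base change preserves injections / exactness; localisations are flat).
-/

set_option autoImplicit false
set_option linter.dupNamespace false

noncomputable section

open scoped TensorProduct nonZeroDivisors

namespace Summit.BirchSwinnertonDyer.BirchSwinnertonDyer.Theorems.LambdaLowerBoundO.FinitenessFromDuality

open Summit.BirchSwinnertonDyer.BirchSwinnertonDyer.Theorems

universe u v w

/-! ## §1 Generic: `R → K` with `K` a field -/

section Generic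

variable (R : Type u) (K : Type v) [CommRing R] [Field K] [Algebra R K]

/-- **(H-b) extension-closure of «finite rank after base change»**: tensoring is right exact, so `K ⊗ B` is an extension of
`K ⊗ (B ⧸ A)` by a quotient of `K ⊗ A`; no flatness needed. [folklore] -/
theorem finite_baseChange_of_submodule {B : Type w} [AddCommGroup B] [Module R B]
    (A : Submodule R B) [Module.Finite K (K ⊗[R] A)] [Module.Finite K (K ⊗[R] (B ⧸ A))] :
    Module.Finite K (K ⊗[R] B) := by
  let f : K ⊗[R] A →ₗ[K] K ⊗[R] B := A.subtype.baseChange K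
  let g : K ⊗[R] B →ₗ[K] K ⊗[R] (B ⧸ A) := A.mkQ.baseChange K
  have hfg : Function.Exact f g := by
    have h := lTensor_exact K (LinearMap.exact_subtype_mkQ A) (Submodule.mkQ_surjective A)
    intro y
    simpa [f, g, LinearMap.baseChange_eq_ltensor] using h y
  have hg : Function.Surjective g := by
    simpa [g, LinearMap.baseChange_eq_ltensor] using
      LinearMap.lTensor_surjective K (Submodule.mkQ_surjective A)
  haveI : Module.Finite K (LinearMap.range f) := Module.Finite.range f
  haveI : Module.Finite K ((K ⊗[R] B) ⧸ LinearMap.range f) :=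
    Module.Finite.equiv (hfg.linearEquivOfSurjective hg).symm
  exact Module.Finite.of_submodule_quotient (LinearMap.range f)

/-- **(H-c) an elementwise `R`-torsion module dies after base change to `K`** (each element killed by some `a : R` that becomes a
unit in `K`). [folklore] -/
theorem subsingleton_baseChange_of_torsion {M : Type w} [AddCommGroup M] [Module R M]
    (htor : ∀ m : M, ∃ a : R, IsUnit (algebraMap R K a) ∧ a • m = 0) :
    Subsingleton (K ⊗[R] M) := by
  refine ⟨fun x y ↦ ?_⟩
  suffices h : ∀ z : K ⊗[R] M, z = 0 by rw [h x, h y]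
  intro z
  induction z using TensorProduct.induction_on with
  | zero => rfl
  | tmul k m =>
      obtain ⟨a, ha, ham⟩ := htor m
      obtain ⟨u, hu⟩ := ha
      have : k ⊗ₜ[R] m = (u⁻¹ : Kˣ).1 • ((algebraMap R K a) • (k ⊗ₜ[R] m)) := by
        rw [← mul_smul, ← hu, Units.inv_mul, one_smul]
      rw [this, algebraMap_smul, TensorProduct.smul_tmul', TensorProduct.smul_tmul, ham,
        TensorProduct.tmul_zero, smul_zero]
  | add x y hx hy => rw [hx, hy, add_zero]

/-- (H-c, `Module.Finite` form) an elementwise `R`-torsion module is finite (indeed zero) after base change to `K`. [folklore] -/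
theorem finite_baseChange_of_torsion {M : Type w} [AddCommGroup M] [Module R M]
    (htor : ∀ m : M, ∃ a : R, IsUnit (algebraMap R K a) ∧ a • m = 0) :
    Module.Finite K (K ⊗[R] M) := by
  haveI := subsingleton_baseChange_of_torsion R K htor
  infer_instance

/-- **(L1) clause (8) of the duality datum is derivable.** One currency: `pair : P → D`, `locd : H → P`, `Z ≤ H`. Hypotheses: `K ⊗ D`
finite, `K ⊗ (H ⧸ Z)` finite (= clause (7)), `K` flat over `R`, and (DH) `pair t = 0 → ∃ a, a a unit in K ∧ ∃ x, a • t = locd x`.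
Conclusion: `K ⊗ (P ⧸ locd Z)` finite. (ORTH)/(EH) unused; no finiteness of any local block of `P` is used.
[cite: Matsumura1987, §7 (flat base change)] -/
theorem finite_baseChange_quotient_of_dualityData [Module.Flat R K]
    {P H D : Type w} [AddCommGroup P] [Module R P] [AddCommGroup H] [Module R H]
    [AddCommGroup D] [Module R D]
    (pair : P →ₗ[R] D) (locd : H →ₗ[R] P) (Z : Submodule R H)
    [Module.Finite K (K ⊗[R] D)] [Module.Finite K (K ⊗[R] (H ⧸ Z))]
    (hDH : ∀ t : P, pair t = 0 → ∃ a : R, IsUnit (algebraMap R K a) ∧ ∃ x : H, a • t = locd x) :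
    Module.Finite K (K ⊗[R] (P ⧸ Z.map locd)) := by
  classical
  set LZ : Submodule R P := Z.map locd with hLZ
  set LH : Submodule R P := LinearMap.range locd with hLH
  set Kp : Submodule R P := LinearMap.ker pair with hKp
  have hZH : LZ ≤ LH := by
    rintro _ ⟨x, -, rfl⟩; exact ⟨x, rfl⟩
  -- the two intermediate submodules of `Q := P ⧸ LZ`
  set S₁ : Submodule R (P ⧸ LZ) := LH.map LZ.mkQ with hS₁
  set S₂ : Submodule R (P ⧸ LZ) := (LH ⊔ Kp).map LZ.mkQ with hS₂
  have h12 : S₁ ≤ S₂ := Submodule.map_mono le_sup_left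
  -- (a) `K ⊗ S₁` finite: `S₁` is a quotient of `H ⧸ Z`
  have hZle : Z ≤ LinearMap.ker (LZ.mkQ ∘ₗ locd) := by
    intro x hx
    simp only [LinearMap.mem_ker, LinearMap.coe_comp, Function.comp_apply, Submodule.mkQ_apply,
      Submodule.Quotient.mk_eq_zero]
    exact ⟨x, hx, rfl⟩
  let φ : (H ⧸ Z) →ₗ[R] (P ⧸ LZ) := Z.liftQ (LZ.mkQ ∘ₗ locd) hZle
  have hφ : LinearMap.range φ = S₁ := by
    rw [Submodule.range_liftQ, LinearMap.range_comp, hS₁, hLH]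
  haveI hS₁fin : Module.Finite K (K ⊗[R] S₁) := by
    have hsurj : Function.Surjective (φ.rangeRestrict) := LinearMap.surjective_rangeRestrict φ
    have : Module.Finite K (K ⊗[R] (LinearMap.range φ)) := by
      refine Module.Finite.of_surjective ((φ.rangeRestrict).baseChange K) ?_
      simpa [LinearMap.baseChange_eq_ltensor] using LinearMap.lTensor_surjective K hsurj
    rw [hφ] at this
    exact this
  -- (b) `S₂ ⧸ S₁` is torsion (this is (DH)), hence dies after base change
  let S₁₂ : Submodule R S₂ := S₁.comap S₂.subtype
  haveI : Module.Finite K (K ⊗[R] S₁₂) := by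
    let e : S₁ ≃ₗ[R] S₁₂ :=
      (Submodule.comapSubtypeEquivOfLe h12).symm
    exact Module.Finite.equiv (LinearEquiv.baseChange R K _ _ e)
  haveI : Module.Finite K (K ⊗[R] (S₂ ⧸ S₁₂)) := by
    refine finite_baseChange_of_torsion R K fun m ↦ ?_
    induction m using Submodule.Quotient.induction_on with
    | H s =>
      obtain ⟨s, hs⟩ := s
      rw [hS₂, Submodule.mem_map] at hs
      obtain ⟨p, hp, rfl⟩ := hs
      obtain ⟨l, hl, t, ht, rfl⟩ := Submodule.mem_sup.1 hp
      rw [hKp, LinearMap.mem_ker] at ht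
      obtain ⟨a, ha, x, hx⟩ := hDH t ht
      refine ⟨a, ha, ?_⟩
      rw [← Submodule.Quotient.mk_smul, Submodule.Quotient.mk_eq_zero, Submodule.mem_comap]
      change a • LZ.mkQ (l + t) ∈ S₁
      rw [← map_smul, smul_add, hx, hS₁]
      exact ⟨a • l + locd x, Submodule.add_mem _ (Submodule.smul_mem _ a hl) ⟨x, rfl⟩, rfl⟩
  haveI hS₂fin : Module.Finite K (K ⊗[R] S₂) := finite_baseChange_of_submodule R K S₁₂
  -- (c) `Q ⧸ S₂ ≃ P ⧸ (LH ⊔ Kp)` is a quotient of `P ⧸ Kp ↪ D`: flatness + finiteness of `K ⊗ D`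
  haveI : Module.Finite K (K ⊗[R] ((P ⧸ LZ) ⧸ S₂)) := by
    have hle : LZ ≤ LH ⊔ Kp := hZH.trans le_sup_left
    let e : ((P ⧸ LZ) ⧸ S₂) ≃ₗ[R] P ⧸ (LH ⊔ Kp) := Submodule.quotientQuotientEquivQuotient LZ (LH ⊔ Kp) hle
    -- `P ⧸ Kp ↪ D`
    let ι : (P ⧸ Kp) →ₗ[R] D := Kp.liftQ pair le_rfl
    have hι : Function.Injective ι := by
      rw [← LinearMap.ker_eq_bot]
      exact Submodule.ker_liftQ_eq_bot _ _ _ (by rw [hKp])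
    haveI : Module.Finite K (K ⊗[R] (P ⧸ Kp)) :=
      Module.Finite.of_injective (ι.baseChange K) (by
        simpa [LinearMap.baseChange_eq_ltensor] using
          Module.Flat.lTensor_preserves_injective_linearMap ι hι)
    -- `P ⧸ Kp ↠ P ⧸ (LH ⊔ Kp)`
    let ψ : (P ⧸ Kp) →ₗ[R] P ⧸ (LH ⊔ Kp) := Submodule.factor (le_sup_right : Kp ≤ LH ⊔ Kp)
    have hψ : Function.Surjective ψ := Submodule.factor_surjective _
    haveI : Module.Finite K (K ⊗[R] (P ⧸ (LH ⊔ Kp))) := by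
      refine Module.Finite.of_surjective (ψ.baseChange K) ?_
      simpa [LinearMap.baseChange_eq_ltensor] using LinearMap.lTensor_surjective K hψ
    exact Module.Finite.equiv (LinearEquiv.baseChange R K _ _ e.symm)
  exact finite_baseChange_of_submodule R K S₂

/-- **(L2) forgetting blocks can only LOWER the counted rank.** For a surjection `π : P ↠ P♮` (projection away from the level blocks) and
`L ≤ P`: `finrank K (K ⊗ (P♮ ⧸ π L)) ≤ finrank K (K ⊗ (P ⧸ L))` as soon as the right-hand side is `Module.Finite` (supplied by (L1)); so
the place-cut COUNT may be run on the good factor only, while the level blocks stay inside `P` as (EH)/(DH) test space. [folklore] -/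
theorem finrank_baseChange_quotient_map_le {P P' : Type w} [AddCommGroup P] [Module R P]
    [AddCommGroup P'] [Module R P'] (π : P →ₗ[R] P') (hπ : Function.Surjective π)
    (L : Submodule R P) [Module.Finite K (K ⊗[R] (P ⧸ L))] :
    Module.finrank K (K ⊗[R] (P' ⧸ L.map π)) ≤ Module.finrank K (K ⊗[R] (P ⧸ L)) := by
  let g : (P ⧸ L) →ₗ[R] (P' ⧸ L.map π) := L.mapQ (L.map π) π (Submodule.le_comap_map π L)
  have hg : Function.Surjective g := by
    rintro ⟨y⟩
    obtain ⟨x, rfl⟩ := hπ y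
    exact ⟨Submodule.Quotient.mk x, rfl⟩
  have hG : Function.Surjective (g.baseChange K) := by
    simpa [LinearMap.baseChange_eq_ltensor] using LinearMap.lTensor_surjective K hg
  calc Module.finrank K (K ⊗[R] (P' ⧸ L.map π))
      = Module.finrank K (LinearMap.range (g.baseChange K)) := by
          rw [LinearMap.range_eq_top.2 hG, finrank_top]
    _ ≤ Module.finrank K (K ⊗[R] (P ⧸ L)) := LinearMap.finrank_range_le _

end Generic

/-! ## §2 The datum's literal currency: `R = ℤ_[p]`, `K = ℚ_[p]`, slack `a ≠ 0` -/

/-- a non-zero `p`-adic integer becomes a unit in `ℚ_[p]`. [folklore] -/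
theorem isUnit_algebraMap_padicInt_of_ne_zero {p : ℕ} [Fact p.Prime] {a : ℤ_[p]} (ha : a ≠ 0) :
    IsUnit (algebraMap ℤ_[p] ℚ_[p] a) :=
  (IsFractionRing.to_map_ne_zero_of_mem_nonZeroDivisors (mem_nonZeroDivisors_of_ne_zero ha)).isUnit

/-- **(L1-cor) clause (8) in the currency of `stub_onePairSupply`**: with `hDH` exactly as clause (DH)
`∀ t, pair t = 0 → ∃ a : ℤ_[p], a ≠ 0 ∧ ∃ x, a • t = locd x` (`ℚ_[p]` is flat over `ℤ_[p]`: a localisation). [folklore] -/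
theorem finite_padic_baseChange_quotient_of_dualityData (p : ℕ) [Fact p.Prime]
    {P H D : Type w} [AddCommGroup P] [Module ℤ_[p] P] [AddCommGroup H] [Module ℤ_[p] H]
    [AddCommGroup D] [Module ℤ_[p] D]
    (pair : P →ₗ[ℤ_[p]] D) (locd : H →ₗ[ℤ_[p]] P) (Z : Submodule ℤ_[p] H)
    [Module.Finite ℚ_[p] (ℚ_[p] ⊗[ℤ_[p]] D)] [Module.Finite ℚ_[p] (ℚ_[p] ⊗[ℤ_[p]] (H ⧸ Z))]
    (hDH : ∀ t : P, pair t = 0 → ∃ a : ℤ_[p], a ≠ 0 ∧ ∃ x : H, a • t = locd x) :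
    Module.Finite ℚ_[p] (ℚ_[p] ⊗[ℤ_[p]] (P ⧸ Z.map locd)) := by
  haveI : Module.Flat ℤ_[p] ℚ_[p] := IsLocalization.flat ℚ_[p] (nonZeroDivisors ℤ_[p])
  exact finite_baseChange_quotient_of_dualityData ℤ_[p] ℚ_[p] pair locd Z fun t ht ↦ by
    obtain ⟨a, ha, x, hx⟩ := hDH t ht
    exact ⟨a, isUnit_algebraMap_padicInt_of_ne_zero ha, x, hx⟩

/-- **(H-a) adapter for the `D`-slot of (L1)**: a module finite over a `ℤ_[p]`-algebra `O` that is itself module-finite over `ℤ_[p]`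
(`O = 𝒪 = padicCoeffIntegers S`, `D = Sg⋆` finite over `𝒪` by p665052) is finite after `ℚ_[p] ⊗[ℤ_[p]] -`. [folklore] -/
theorem finite_padic_baseChange_of_finite_over (p : ℕ) [Fact p.Prime] (O : Type u) [CommRing O]
    [Algebra ℤ_[p] O] [Module.Finite ℤ_[p] O] (D : Type w) [AddCommGroup D] [Module O D]
    [Module ℤ_[p] D] [IsScalarTower ℤ_[p] O D] [Module.Finite O D] :
    Module.Finite ℚ_[p] (ℚ_[p] ⊗[ℤ_[p]] D) := by
  haveI : Module.Finite ℤ_[p] D := Module.Finite.trans O D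
  infer_instance

/-- `Submodule.map locd Z` IS the datum's `Submodule.span ℤ_[p] (locd '' Z)`. [folklore] -/
theorem span_image_eq_map {p : ℕ} [Fact p.Prime] {P H : Type w} [AddCommGroup P] [Module ℤ_[p] P]
    [AddCommGroup H] [Module ℤ_[p] H] (locd : H →ₗ[ℤ_[p]] P) (Z : Submodule ℤ_[p] H) :
    Submodule.span ℤ_[p] (locd '' (Z : Set H)) = Z.map locd := by
  rw [← Submodule.map_span, Submodule.span_eq]

end Summit.BirchSwinnertonDyer.BirchSwinnertonDyer.Theorems.LambdaLowerBoundO.FinitenessFromDuality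

/-! ## §3 The dischargers in the ENTRY's binder currency (`LambdaLowerBoundO.le_finrank_characterModule_of_intDualityData`) -/

namespace Summit.BirchSwinnertonDyer.BirchSwinnertonDyer.Theorems.LambdaLowerBoundO

open Summit.BirchSwinnertonDyer.BirchSwinnertonDyer.Theorems
open Literature.NumberTheory.EllipticCurves Literature.NumberTheory.EllipticCurves.GreenbergSelmer
open Literature.NumberTheory.GaloisRepresentations

/-- **Clause (8) `hfinP` of the mixed-currency entry, DISCHARGED** from (DH), clause (7) `hfinH` and `Frac 𝒪 ⊗_𝒪 Sel⋆` finite — in the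
exact binders of `le_finrank_characterModule_of_intDualityData` (additive `pair`/`locd` with the `ι = padicIntToCoeffIntegers S`-compatibility
equations, `Z : Submodule 𝒪 H`, `hfinH` in `Frac 𝒪`-currency). Proof: install `Algebra ℤ_p 𝒪 := ι.toAlgebra`, `ℤ_p`-structures by
`Module.compHom`, upgrade `pair`/`locd` to `ℤ_p`-linear maps, convert the two finiteness inputs to `ℚ_p ⊗_{ℤ_p}`-currency
(`CharIdealLambda.IntDescent.finite_baseChange_iff`, `CharIdealLambda.finite_baseChange_quotient_restrictScalars_iff`) and apply (L1-cor).
[cite: Kobayashi2003, Thm. 7.3 ((7.21), p. 13)] [cite: Washington1997, §13.2] -/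
theorem finite_padic_baseChange_quotient_span_of_intDualityData {p : ℕ} [Fact p.Prime] (S : Set (PadicAlgCl p))
    [FiniteDimensional ℚ_[p] (padicCoeffField S)]
    {Sel : Type} [AddCommGroup Sel] [Module ↥(padicCoeffIntegers S) Sel]
    [Module.Finite (FractionRing ↥(padicCoeffIntegers S))
      (TensorProduct ↥(padicCoeffIntegers S) (FractionRing ↥(padicCoeffIntegers S)) (CharacterModule Sel))]
    (P : Type) [AddCommGroup P] [Module ℤ_[p] P] (H : Type) [AddCommGroup H] [Module ↥(padicCoeffIntegers S) H]
    (pair : P →+ CharacterModule Sel) (locd : H →+ P) (Z : Submodule ↥(padicCoeffIntegers S) H)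
    (hpair : ∀ (z : ℤ_[p]) (t : P) (s : Sel), pair (z • t) s = pair t (padicIntToCoeffIntegers S z • s))
    (hlocd : ∀ (z : ℤ_[p]) (x : H), locd (padicIntToCoeffIntegers S z • x) = z • locd x)
    (hDH : ∀ t : P, pair t = 0 → ∃ a : ℤ_[p], a ≠ 0 ∧ ∃ x : H, a • t = locd x)
    (hfinH : Module.Finite (FractionRing ↥(padicCoeffIntegers S))
      (TensorProduct ↥(padicCoeffIntegers S) (FractionRing ↥(padicCoeffIntegers S)) (H ⧸ Z))) :
    Module.Finite ℚ_[p] (TensorProduct ℤ_[p] ℚ_[p] (P ⧸ Submodule.span ℤ_[p] (locd '' (Z : Set H)))) := by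
  -- the `ℤ_p`-algebra structure of `𝒪` through `ι` (local; the crux carries none)
  letI ialg : Algebra ℤ_[p] ↥(padicCoeffIntegers S) := (padicIntToCoeffIntegers S).toAlgebra
  have halg : ∀ z : ℤ_[p], algebraMap ℤ_[p] ↥(padicCoeffIntegers S) z = padicIntToCoeffIntegers S z := fun _ ↦ rfl
  have hinj : Function.Injective (padicIntToCoeffIntegers S) := fun a b h ↦ by
    have h' := congrArg (fun x : ↥(padicCoeffIntegers S) ↦ (x : PadicAlgCl p)) h
    simp only [coe_padicIntToCoeffIntegers] at h'
    exact Subtype.ext ((algebraMap ℚ_[p] (PadicAlgCl p)).injective h')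
  haveI : FaithfulSMul ℤ_[p] ↥(padicCoeffIntegers S) := (faithfulSMul_iff_algebraMap_injective ℤ_[p] _).2 hinj
  -- `𝒪` is free of finite rank over `ℤ_p` (an additive `ℤ_p`-basis, `exists_addEquiv_padicInt_pi`)
  obtain ⟨f, B, hB⟩ := exists_addEquiv_padicInt_pi (p := p) S
  let Bₗ : (Fin f → ℤ_[p]) ≃ₗ[ℤ_[p]] ↥(padicCoeffIntegers S) :=
    { B with map_smul' := fun z c ↦ by rw [AddEquiv.toFun_eq_coe, hB, RingHom.id_apply, Algebra.smul_def, halg] }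
  haveI : Module.Free ℤ_[p] ↥(padicCoeffIntegers S) := Module.Free.of_equiv Bₗ
  haveI : Module.Finite ℤ_[p] ↥(padicCoeffIntegers S) := Module.Finite.equiv Bₗ
  haveI : Algebra.IsAlgebraic ℤ_[p] ↥(padicCoeffIntegers S) := Algebra.IsAlgebraic.of_finite ℤ_[p] _
  -- `ℚ_p → Frac 𝒪`
  set Kf := FractionRing ↥(padicCoeffIntegers S) with hKf
  have hinjK : Function.Injective (algebraMap ℤ_[p] Kf) := by
    rw [IsScalarTower.algebraMap_eq ℤ_[p] ↥(padicCoeffIntegers S) Kf]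
    exact (IsFractionRing.injective ↥(padicCoeffIntegers S) Kf).comp hinj
  letI : Algebra ℚ_[p] Kf := (IsFractionRing.lift hinjK : ℚ_[p] →+* Kf).toAlgebra
  haveI : IsScalarTower ℤ_[p] ℚ_[p] Kf :=
    IsScalarTower.of_algebraMap_eq fun z ↦ (IsFractionRing.lift_algebraMap hinjK z).symm
  haveI : FiniteDimensional ℚ_[p] Kf :=
    CharIdealLambda.IntDescent.finiteDimensional_fractionField (R := ℤ_[p]) (A := ↥(padicCoeffIntegers S)) ℚ_[p] Kf
  -- `ℤ_p`-structures on the `𝒪`-modules by restriction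
  letI iSel : Module ℤ_[p] Sel := Module.compHom Sel (padicIntToCoeffIntegers S)
  haveI : IsScalarTower ℤ_[p] ↥(padicCoeffIntegers S) Sel := ⟨fun z a s ↦ mul_smul (padicIntToCoeffIntegers S z) a s⟩
  letI iH : Module ℤ_[p] H := Module.compHom H (padicIntToCoeffIntegers S)
  haveI : IsScalarTower ℤ_[p] ↥(padicCoeffIntegers S) H := ⟨fun z a s ↦ mul_smul (padicIntToCoeffIntegers S z) a s⟩
  haveI : IsScalarTower ℤ_[p] ↥(padicCoeffIntegers S) (CharacterModule Sel) := CharIdealLambda.IntDescent.isScalarTower_characterModule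
  -- linear upgrades of `pair`, `locd`
  let pairₗ : P →ₗ[ℤ_[p]] CharacterModule Sel :=
    { pair with
      map_smul' := fun z t ↦ by
        refine CharacterModule.ext _ fun s ↦ ?_
        rw [AddMonoidHom.toFun_eq_coe, RingHom.id_apply, CharacterModule.smul_apply, hpair]
        rfl }
  let locdₗ : H →ₗ[ℤ_[p]] P :=
    { locd with
      map_smul' := fun z x ↦ by
        rw [AddMonoidHom.toFun_eq_coe, RingHom.id_apply, ← hlocd]
        rfl }
  set Zr : Submodule ℤ_[p] H := Z.restrictScalars ℤ_[p] with hZr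
  have hmap : Zr.map locdₗ = Submodule.span ℤ_[p] (locd '' (Z : Set H)) := by
    refine le_antisymm ?_ (Submodule.span_le.mpr ?_)
    · rintro _ ⟨x, hx, rfl⟩
      exact Submodule.subset_span ⟨x, hx, rfl⟩
    · rintro _ ⟨x, hx, rfl⟩
      exact ⟨x, hx, rfl⟩
  -- the two finiteness inputs in `ℚ_p ⊗_{ℤ_p}`-currency
  haveI : Module.Finite ℚ_[p] (TensorProduct ℤ_[p] ℚ_[p] (H ⧸ Zr)) := by
    rw [hZr, CharIdealLambda.finite_baseChange_quotient_restrictScalars_iff ℚ_[p] Z,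
      CharIdealLambda.IntDescent.finite_baseChange_iff (R := ℤ_[p]) (A := ↥(padicCoeffIntegers S)) ℚ_[p] Kf (M := H ⧸ Z)]
    exact hfinH
  haveI : Module.Finite ℚ_[p] (TensorProduct ℤ_[p] ℚ_[p] (CharacterModule Sel)) := by
    rw [CharIdealLambda.IntDescent.finite_baseChange_iff (R := ℤ_[p]) (A := ↥(padicCoeffIntegers S)) ℚ_[p] Kf
      (M := CharacterModule Sel)]
    infer_instance
  have hDH' : ∀ t : P, pairₗ t = 0 → ∃ a : ℤ_[p], a ≠ 0 ∧ ∃ x : H, a • t = locdₗ x := fun t ht ↦ hDH t ht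
  have hfin := FinitenessFromDuality.finite_padic_baseChange_quotient_of_dualityData p pairₗ locdₗ Zr hDH'
  rw [hmap] at hfin
  exact hfin

/-- **The mixed-currency N5 entry WITHOUT clause (8)**: `le_finrank_characterModule_of_intDualityData` (p679392) with the hypothesis
`hfinP : Module.Finite ℚ_[p] (ℚ_[p] ⊗[ℤ_[p]] (P ⧸ span (locd Z)))` removed — it is `finite_padic_baseChange_quotient_span_of_intDualityData`.
All other binders VERBATIM (S79 (a): the split supplies never produce clause (8); the level blocks `w ∣ M` ride inside `P` uncounted).
[cite: Kobayashi2003, Thm. 7.3 ((7.21), p. 13)] [cite: MilneADT2006, Ch. I, Thm. 4.10] [cite: Washington1997, §13.2] -/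
theorem le_finrank_characterModule_of_intDualityData_finFree {p : ℕ} [Fact p.Prime] (S : Set (PadicAlgCl p))
    [FiniteDimensional ℚ_[p] (padicCoeffField S)]
    {Sel : Type} [AddCommGroup Sel] [Module ↥(padicCoeffIntegers S) Sel]
    [Module.Finite (FractionRing ↥(padicCoeffIntegers S)) (TensorProduct ↥(padicCoeffIntegers S) (FractionRing ↥(padicCoeffIntegers S)) (CharacterModule Sel))]
    (P : Type) [AddCommGroup P] [Module ℤ_[p] P] (H : Type) [AddCommGroup H] [Module ↥(padicCoeffIntegers S) H]
    (H2 : Type) [AddCommGroup H2] [Module ↥(padicCoeffIntegers S) H2]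
    (pair : P →+ CharacterModule Sel) (locd : H →+ P) (Z : Submodule ↥(padicCoeffIntegers S) H) (Sel₀ : Submodule ↥(padicCoeffIntegers S) Sel)
    (e f : ℕ) (B : (Fin f → ℤ_[p]) ≃+ ↥(padicCoeffIntegers S))
    (hB : ∀ (z : ℤ_[p]) (c : Fin f → ℤ_[p]), B (z • c) = padicIntToCoeffIntegers S z * B c)
    (hpair : ∀ (z : ℤ_[p]) (t : P) (s : Sel), pair (z • t) s = pair t (padicIntToCoeffIntegers S z • s))
    (hlocd : ∀ (z : ℤ_[p]) (x : H), locd (padicIntToCoeffIntegers S z • x) = z • locd x)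
    (hEH : ∀ x ∈ Z, pair (locd x) = 0) (horth : ∀ s ∈ Sel₀, ∀ t : P, pair t s = 0)
    (hDH : ∀ t : P, pair t = 0 → ∃ a : ℤ_[p], a ≠ 0 ∧ ∃ x : H, a • t = locd x)
    (hfinH : Module.Finite (FractionRing ↥(padicCoeffIntegers S))
      (TensorProduct ↥(padicCoeffIntegers S) (FractionRing ↥(padicCoeffIntegers S)) (H ⧸ Z)))
    {m : ℕ} (hi : f * (m + e) ≤ Module.finrank ℚ_[p] (TensorProduct ℤ_[p] ℚ_[p] (P ⧸ Submodule.span ℤ_[p] (locd '' (Z : Set H)))))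
    (hii : Module.finrank (FractionRing ↥(padicCoeffIntegers S))
        (TensorProduct ↥(padicCoeffIntegers S) (FractionRing ↥(padicCoeffIntegers S)) (H ⧸ Z)) ≤
      Module.finrank (FractionRing ↥(padicCoeffIntegers S))
        (TensorProduct ↥(padicCoeffIntegers S) (FractionRing ↥(padicCoeffIntegers S)) H2) + e)
    (hPT : Module.finrank (FractionRing ↥(padicCoeffIntegers S))
        (TensorProduct ↥(padicCoeffIntegers S) (FractionRing ↥(padicCoeffIntegers S)) H2) ≤
      Module.finrank (FractionRing ↥(padicCoeffIntegers S))
        (TensorProduct ↥(padicCoeffIntegers S) (FractionRing ↥(padicCoeffIntegers S)) (CharacterModule ↥Sel₀))) :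
    m ≤ Module.finrank (FractionRing ↥(padicCoeffIntegers S))
      (TensorProduct ↥(padicCoeffIntegers S) (FractionRing ↥(padicCoeffIntegers S)) (CharacterModule Sel)) :=
  le_finrank_characterModule_of_intDualityData S P H H2 pair locd Z Sel₀ e f B hB hpair hlocd hEH horth hDH hfinH
    (finite_padic_baseChange_quotient_span_of_intDualityData S P H pair locd Z hpair hlocd hDH hfinH) hi hii hPT

end Summit.BirchSwinnertonDyer.BirchSwinnertonDyer.Theorems.LambdaLowerBoundO

end
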